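import Summits.PneNP.PneNP.Theorems.ChebyshevTracialDesignPsdPieces
import HarnessLib

/-!
# Cell pnp-psdrank, route `ChebyshevTracialDesign`: the THREE-TERM BOUND of the psd rung and its `TracialValueLEAt` form — the crux's
# conclusion for every tight psd strategy, modulo the dense non-crossing psd cell

Harmonic backbone of the crux `TracialDecayExp20` (stmt-PneNP-19878), brick 53 (prover g11): the psd twin of brick 50a
(`…RungAssemblyAll.value_le_three_terms`), assembling brick 52's pieces (`…PsdPieces.psd_piece_value_le`). For a tight-orthogonal psd rectangle
`(X, Y)` of dimension `r ≥ 1`, an exact design `(n, t = 2c'+1, T, D, B_v, C, w)` (`4 ≤ D ≤ 2c'`, `n ≤ 4t`, `T + 2q + 2 ≤ t`, `q ≤ D`, `D + 2q + 3 ≤ t`,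
`2q² + q ≤ n/2`, `40q ≤ n`), a family `A` of `t`-cuts, a family `B` of perfect matchings and a weighted Kupavskii–Zakharov approximation of `(B, y)` for
the TRACE WEIGHT `y(M) = tr(Y_M)/r` (parameter `τ > 0`, cores `≤ q`):
* §1 **`psd_value_le_three_terms`** — `Σ_{U∈A} Σ_{M∈B} W(U,M)·tr(X_U Y_M) ≤ B_v·r·((τ^{q+1})⁻¹ + τ^{q+1}·n^q·4^q·√P_{D−4} + 2·4^q·τ^{q+1}·(Ψ + β))`,
  assuming the DENSE NON-CROSSING PSD CELL `hH` in the reduced instances `K_m`, `n − 2q ≤ m ≤ n` (a tight psd strategy of `K_m` whose matching side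
  carries a `(PM_m, τ)`-homogeneous trace weight, both trace densities `≥ exp(−c₀ dq m)`, has value `≤ B_v·Ψ·r` against every reduced design of degree
  `D' ∈ [D − q, D]`): remainder by trace mass (`y(ℱ') ≤ |PM_n|/τ^{q+1}`), pieces by brick 52, `k ≤ τ^{q+1}·n^q`, `Σ_i |⟨S_i⟩| ≤ τ^{q+1}·y(B) ≤ τ^{q+1}·|PM_n|`;
* §2 **`tracialValueLEAt_of_psdDenseCell`** — the same as `TracialValueLEAt (levelWeight n t C w) (B_v·(…)) r` for EVERY `r ≥ 1`, the weighted spread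
  approximation of the whole trace profile being chosen inside (`exists_weightedSpreadApproximation`, `y ∈ [0,1]` by the contraction bounds).
Reading: this is the exact psd analogue of the `r = 1` rung's assembly; there the dense cell is discharged by the virtual-nonnegativity / spectral
non-tightness estimate modulo Keevash–Lifshitz Thm 1.8 (bricks 46/47/50b), here it is THE open core of the crux (MEMO-12 §2(d), MEMO-13 §3b) — the file
makes «crux ⇐ dense non-crossing psd cell» a kernel implication with all bookkeeping (pins, junk, crossing cells, reduced designs) discharged.
[cite: KupavskiiZakharov2022, Lemma 11] [cite: Rothvoss2017, §2 (PDF p. 6)] [cite: BrietDadushPokutta2014, Thm. 6 (§3)]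
Stature: support/instrument (no defs). WHAT THIS IS NOT: not a proof of the crux or of a psd rung (the dense cell is a hypothesis), nothing on psd rank,
no P-vs-NP content. Supports stmt-PneNP-19878.
-/

set_option linter.dupNamespace false -- `Summit.PneNP.PneNP.…`: summit = sub-problem (D-0017)

noncomputable section

namespace Summit.PneNP.PneNP.Theorems.ChebyshevTracialDesignPsdAssembly

open Finset Matrix Literature.Combinatorics.Optimization
open Literature.Barriers.PneNP hiding verts
open Literature.Combinatorics.SetFamily
open Literature.Combinatorics.SimpleGraph.CycleSpace
open Literature.Combinatorics.AssociationSchemes.CutMatchingRestriction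
open Literature.Combinatorics.AssociationSchemes.CutMatchingRestrictionStrategies
open Literature.Combinatorics.AssociationSchemes.HomogeneousMatchingFamilies
open Summit.PneNP.PneNP.Theorems.ChebyshevTracialDesignProfilePolynomial (card_pmatch_pos)
open Summit.PneNP.PneNP.Theorems.ChebyshevTracialDesignDipoleHitRatio (card_pmatch_eq_pmCount)
open Summit.PneNP.PneNP.Theorems.ChebyshevTracialDesignRungCells
open Summit.PneNP.PneNP.Theorems.ChebyshevTracialDesignRungPieces
open Summit.PneNP.PneNP.Theorems.ChebyshevTracialDesignPsdCells
open Summit.PneNP.PneNP.Theorems.ChebyshevTracialDesignPsdPieces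

variable {n : ℕ}

/-! ### §1 The three-term bound for a tight psd strategy -/

/-- **The three-term bound for a tight psd strategy** (psd twin of brick 50a `value_le_three_terms`). For `n` even, `n ≥ 1`, an exact design
`(n, t = 2c'+1, T, D, B_v, C, w)` with `4 ≤ D ≤ 2c'`, `n ≤ 4t`, `T + 2q + 2 ≤ t`, `q ≤ D`, `D + 2q + 3 ≤ t`, `2q² + q ≤ n/2`, `40q ≤ n`, a tight-orthogonal psd
rectangle `(X, Y)` of dimension `r ≥ 1`, a family `A` of `t`-cuts, a family `B` of perfect matchings and a weighted spread approximation `Dk` of `(B, y)`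
for the trace weight `y(M) = tr(Y_M)/r` (parameter `τ > 0`, cores `≤ q`), assuming the dense non-crossing psd cell `hH` in the reduced instances
(threshold `exp(−c₀ dq m) ≤ β` for `n − 2q ≤ m ≤ n`):
`Σ_{U∈A} Σ_{M∈B} W(U,M)·tr(X_U Y_M) ≤ B_v·r·((τ^{q+1})⁻¹ + τ^{q+1}·n^q·4^q·√P_{D−4} + 2·4^q·τ^{q+1}·(Ψ + β))` — remainder by trace mass, pieces by
`psd_piece_value_le`, `k ≤ τ^{q+1} n^q`, `Σ_i |⟨S_i⟩| ≤ τ^{q+1}·y(B) ≤ τ^{q+1}·|PM_n|`. [cite: KupavskiiZakharov2022, Lemma 11] [cite: Rothvoss2017, §2 (PDF p. 6)]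
[cite: BrietDadushPokutta2014, Thm. 6 (§3)] -/
theorem psd_value_le_three_terms {c' T Dg q n₁ r : ℕ} {Bv τ c₀ β Ψ : ℝ} {C : Finset ℕ} {w : ℕ → ℝ} (hn : Even n) (hn1 : 1 ≤ n) (hr : 0 < r)
    (hdes : IsExactDesign n (2 * c' + 1) T Dg Bv C w) (hDg : Dg ≤ 2 * c') (hDg4 : 4 ≤ Dg)
    (hbal : n ≤ 4 * (2 * c' + 1)) (hq : 40 * q ≤ n) (hn₁ : n₁ + 2 * q ≤ n)
    (hTq : T + 2 * q + 2 ≤ 2 * c' + 1) (hqD : q ≤ Dg) (hDq3 : Dg + 2 * q + 3 ≤ 2 * c' + 1) (hqN : 2 * q * q + q ≤ n / 2) (hτ : 0 < τ)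
    (hH : ∀ (m t'' D' : ℕ) (w' : ℕ → ℝ), n₁ ≤ m → Even m → Odd t'' → m ≤ 5 * t'' → m ≤ 5 * (m - t'') →
      T ≤ t'' → T ≤ m - t'' → D' + 3 ≤ t'' → D' + 3 ≤ m - t'' → Dg ≤ D' + q → D' ≤ Dg →
      (∀ c ∈ C, (Qset m t'' c).Nonempty) →
      (∀ p : Polynomial ℝ, p.natDegree ≤ D' → ∑ c ∈ C, w' c * p.eval (c : ℝ) = -p.eval 0) →
      ∑ c ∈ C, |w' c| ≤ Bv →
      ∀ (X' : OddSet m → Matrix (Fin r) (Fin r) ℝ) (Y' : PMatch m → Matrix (Fin r) (Fin r) ℝ), IsPsdRect X' Y' →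
      ∀ (A' : Finset (OddSet m)), (∀ U ∈ A', U.1.card = t'') →
      ∀ (B' : Finset (PMatch m)),
      IsRelHomogeneousW τ (perfectMatchings (univ : Finset (Fin m)))
        (fun M : Finset (Sym2 (Fin m)) => if hM : IsPMOn univ M then (Y' ⟨M, hM⟩).trace / r else 0) (B'.image Subtype.val) →
      Real.exp (-(c₀ * dq m)) ≤ (∑ U ∈ A', (X' U).trace) / ((r : ℝ) * (m.choose t'' : ℝ)) →
      Real.exp (-(c₀ * dq m)) ≤ (∑ M ∈ B', (Y' M).trace) / ((r : ℝ) * (Fintype.card (PMatch m) : ℝ)) →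
      ∑ U ∈ A', ∑ M ∈ B', levelWeight m t'' C w' U M * (X' U * Y' M).trace ≤ Bv * Ψ * r)
    (hΨ : 0 ≤ Ψ) (hβ : ∀ m : ℕ, n ≤ m + 2 * q → m ≤ n → Real.exp (-(c₀ * dq m)) ≤ β) (hβ0 : 0 ≤ β)
    {X : OddSet n → Matrix (Fin r) (Fin r) ℝ} {Y : PMatch n → Matrix (Fin r) (Fin r) ℝ} (hXY : IsPsdRect X Y)
    (A : Finset (OddSet n)) (hA : ∀ U ∈ A, U.1.card = 2 * c' + 1) (B : Finset (PMatch n))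
    (Dk : WeightedSpreadApproximation (perfectMatchings (univ : Finset (Fin n))) (B.image Subtype.val)
      (fun M : Finset (Sym2 (Fin n)) => if hM : IsPMOn univ M then (Y ⟨M, hM⟩).trace / r else 0) τ q) :
    ∑ U ∈ A, ∑ M ∈ B, levelWeight n (2 * c' + 1) C w U M * (X U * Y M).trace ≤
      Bv * r * ((τ ^ (q + 1))⁻¹ + τ ^ (q + 1) * (n : ℝ) ^ q *
        ((4 : ℝ) ^ q * Real.sqrt (∏ j ∈ range ((Dg - 4) / 2 + 1), ((2 * j + 1 : ℝ) / ((n : ℝ) - 2 * j)))) +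
        2 * (4 : ℝ) ^ q * τ ^ (q + 1) * (Ψ + β)) := by
  classical
  have hBv : 0 ≤ Bv := (sum_nonneg fun c _ => abs_nonneg (w c)).trans hdes.2.2.2.2.2.2
  have hr' : (0 : ℝ) < r := by exact_mod_cast hr
  have hPM : (0 : ℝ) < Fintype.card (PMatch n) := by exact_mod_cast card_pmatch_pos hn
  have h𝒜 : ((perfectMatchings (univ : Finset (Fin n))).card : ℝ) = Fintype.card (PMatch n) := by
    rw [card_pmatch_eq_pmCount, pmCount]
  have h𝒜ne : (perfectMatchings (univ : Finset (Fin n))).Nonempty := by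
    rw [← card_pos]; exact_mod_cast (h𝒜 ▸ hPM : (0 : ℝ) < ((perfectMatchings (univ : Finset (Fin n))).card : ℝ))
  have hy := fun M => traceWeight_mem hXY M
  set P : ℝ := ∏ j ∈ range ((Dg - 4) / 2 + 1), ((2 * j + 1 : ℝ) / ((n : ℝ) - 2 * j)) with hPdef
  -- split along the spread approximation
  have hsplit : ∑ U ∈ A, ∑ M ∈ B, levelWeight n (2 * c' + 1) C w U M * (X U * Y M).trace =
      ∑ U ∈ A, ∑ M ∈ B.filter (fun M => M.1 ∈ Dk.remainder), levelWeight n (2 * c' + 1) C w U M * (X U * Y M).trace +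
        ∑ i : Fin Dk.k, ∑ U ∈ A, ∑ M ∈ B.filter (fun M => M.1 ∈ Dk.piece i), levelWeight n (2 * c' + 1) C w U M * (X U * Y M).trace := by
    rw [sum_comm (s := univ), ← sum_add_distrib]
    exact sum_congr rfl fun U _ => sum_eq_remainder_add_piecesW B Dk _
  rw [hsplit]
  -- the remainder, priced by its trace mass
  have hrem : ∑ U ∈ A, ∑ M ∈ B.filter (fun M => M.1 ∈ Dk.remainder), levelWeight n (2 * c' + 1) C w U M * (X U * Y M).trace ≤
      Bv * r * (τ ^ (q + 1))⁻¹ := by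
    refine (le_abs_self _).trans ((abs_cell_value_le_col hr C w hXY A _).trans ?_)
    rw [sum_trace_eq_mul_wmass hr Y, image_val_filter_mem_eq B Dk.remainder_subset]
    have h1 : wmass (fun M : Finset (Sym2 (Fin n)) => if hM : IsPMOn univ M then (Y ⟨M, hM⟩).trace / r else 0) Dk.remainder /
        Fintype.card (PMatch n) ≤ (τ ^ (q + 1))⁻¹ := by
      rw [← h𝒜]; exact Dk.wmass_remainder_div_le hτ h𝒜ne
    rw [mul_div_assoc, mul_assoc]
    exact mul_le_mul hdes.2.2.2.2.2.2 (mul_le_mul_of_nonneg_left h1 hr'.le)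
      (mul_nonneg hr'.le (div_nonneg (wmass_nonneg (fun M => (hy M).1) _) (Nat.cast_nonneg _))) hBv
  -- the pieces
  have hpieces : ∀ i : Fin Dk.k, ∑ U ∈ A, ∑ M ∈ B.filter (fun M => M.1 ∈ Dk.piece i), levelWeight n (2 * c' + 1) C w U M * (X U * Y M).trace ≤
      (4 : ℝ) ^ q * (Bv * ((r : ℝ) * Real.sqrt P)) +
        2 * (4 : ℝ) ^ q * (((supersets (perfectMatchings (univ : Finset (Fin n))) (Dk.core i)).card : ℝ) / Fintype.card (PMatch n)) *
          (Bv * (Ψ + β) * r) :=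
    fun i => psd_piece_value_le hn hr hdes hDg hDg4 hbal hq hn₁ hTq hqD hDq3 hqN hH hΨ hβ hβ0 hXY A hA B Dk i
  have hsumpieces : ∑ i : Fin Dk.k, ∑ U ∈ A, ∑ M ∈ B.filter (fun M => M.1 ∈ Dk.piece i), levelWeight n (2 * c' + 1) C w U M * (X U * Y M).trace ≤
      τ ^ (q + 1) * (n : ℝ) ^ q * ((4 : ℝ) ^ q * (Bv * ((r : ℝ) * Real.sqrt P))) + 2 * (4 : ℝ) ^ q * τ ^ (q + 1) * (Bv * (Ψ + β) * r) := by
    refine (sum_le_sum fun i _ => hpieces i).trans ?_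
    rw [sum_add_distrib, sum_const, card_univ, Fintype.card_fin, nsmul_eq_mul]
    have hk := card_piecesW_le hn hn1 (image_val_subset B) (fun M => (hy M).1) (fun M => (hy M).2) hτ Dk
    have hstars : ∑ i : Fin Dk.k, (((supersets (perfectMatchings (univ : Finset (Fin n))) (Dk.core i)).card : ℝ) / Fintype.card (PMatch n)) ≤
        τ ^ (q + 1) := by
      rw [← h𝒜]
      refine (Dk.sum_card_supersets_div_le hτ.le (fun M => (hy M).1) h𝒜ne).trans ?_
      have hY1 : wmass (fun M : Finset (Sym2 (Fin n)) => if hM : IsPMOn univ M then (Y ⟨M, hM⟩).trace / r else 0) (B.image Subtype.val) /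
          (perfectMatchings (univ : Finset (Fin n))).card ≤ 1 := by
        rw [div_le_one (by rw [h𝒜]; exact hPM), h𝒜]
        refine (wmass_le_card (fun M => (hy M).2) _).trans ?_
        rw [card_image_of_injective _ Subtype.val_injective]
        exact_mod_cast (card_le_univ B).trans_eq Finset.card_univ
      calc τ ^ (q + 1) * (wmass (fun M : Finset (Sym2 (Fin n)) => if hM : IsPMOn univ M then (Y ⟨M, hM⟩).trace / r else 0)
            (B.image Subtype.val) / (perfectMatchings (univ : Finset (Fin n))).card)
          ≤ τ ^ (q + 1) * 1 := mul_le_mul_of_nonneg_left hY1 (by positivity)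
        _ = τ ^ (q + 1) := mul_one _
    have hP0 : 0 ≤ Real.sqrt P := Real.sqrt_nonneg _
    have h1 : (Dk.k : ℝ) * ((4 : ℝ) ^ q * (Bv * ((r : ℝ) * Real.sqrt P))) ≤
        τ ^ (q + 1) * (n : ℝ) ^ q * ((4 : ℝ) ^ q * (Bv * ((r : ℝ) * Real.sqrt P))) :=
      mul_le_mul_of_nonneg_right hk (by positivity)
    have hΨβ : 0 ≤ Ψ + β := add_nonneg hΨ hβ0
    have h2 : ∑ i : Fin Dk.k, 2 * (4 : ℝ) ^ q *
        (((supersets (perfectMatchings (univ : Finset (Fin n))) (Dk.core i)).card : ℝ) / Fintype.card (PMatch n)) * (Bv * (Ψ + β) * r) ≤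
        2 * (4 : ℝ) ^ q * τ ^ (q + 1) * (Bv * (Ψ + β) * r) := by
      have : ∑ i : Fin Dk.k, 2 * (4 : ℝ) ^ q *
          (((supersets (perfectMatchings (univ : Finset (Fin n))) (Dk.core i)).card : ℝ) / Fintype.card (PMatch n)) * (Bv * (Ψ + β) * r) =
          2 * (4 : ℝ) ^ q * (Bv * (Ψ + β) * r) *
            ∑ i : Fin Dk.k, (((supersets (perfectMatchings (univ : Finset (Fin n))) (Dk.core i)).card : ℝ) / Fintype.card (PMatch n)) := by
        rw [mul_sum]; exact sum_congr rfl fun i _ => by ring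
      rw [this]
      calc 2 * (4 : ℝ) ^ q * (Bv * (Ψ + β) * r) *
            ∑ i : Fin Dk.k, (((supersets (perfectMatchings (univ : Finset (Fin n))) (Dk.core i)).card : ℝ) / Fintype.card (PMatch n))
          ≤ 2 * (4 : ℝ) ^ q * (Bv * (Ψ + β) * r) * τ ^ (q + 1) := mul_le_mul_of_nonneg_left hstars (by positivity)
        _ = _ := by ring
    linarith
  calc _ ≤ Bv * r * (τ ^ (q + 1))⁻¹ +
        (τ ^ (q + 1) * (n : ℝ) ^ q * ((4 : ℝ) ^ q * (Bv * ((r : ℝ) * Real.sqrt P))) + 2 * (4 : ℝ) ^ q * τ ^ (q + 1) * (Bv * (Ψ + β) * r)) :=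
        add_le_add hrem hsumpieces
    _ = _ := by ring

/-! ### §2 The `TracialValueLEAt` form: the crux's conclusion for one design and one dimension, modulo the dense cell -/

/-- **Tracial value at dimension `r`, modulo the dense non-crossing psd cell.** For `n` even, `n ≥ 1`, an exact design `(n, t = 2c'+1, T, D, B_v, C, w)`
with `4 ≤ D ≤ 2c'`, `n ≤ 4t`, `T + 2q + 2 ≤ t`, `q ≤ D`, `D + 2q + 3 ≤ t`, `2q² + q ≤ n/2`, `40q ≤ n`, a parameter `τ ≥ 1`, and `r ≥ 1`: if the dense
non-crossing psd cell bound `hH` holds in the reduced instances `K_m`, `n − 2q ≤ m ≤ n` (threshold `exp(−c₀ dq m) ≤ β`), then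
`TracialValueLEAt (levelWeight n t C w) (B_v·((τ^{q+1})⁻¹ + τ^{q+1}·n^q·4^q·√P_{D−4} + 2·4^q·τ^{q+1}·(Ψ + β))) r` — the weighted Kupavskii–Zakharov
approximation of the whole trace profile `y(M) = tr(Y_M)/r ∈ [0,1]` is chosen by `exists_weightedSpreadApproximation` and §1 applies on the `t`-cuts
(the weight vanishes off the `t`-cuts). [cite: KupavskiiZakharov2022, Lemma 11] [cite: Rothvoss2017, §2 (PDF p. 6)] [cite: BrietDadushPokutta2014, Thm. 6 (§3)] -/
theorem tracialValueLEAt_of_psdDenseCell {c' T Dg q n₁ r : ℕ} {Bv τ c₀ β Ψ : ℝ} {C : Finset ℕ} {w : ℕ → ℝ} (hn : Even n) (hn1 : 1 ≤ n)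
    (hr : 0 < r) (hdes : IsExactDesign n (2 * c' + 1) T Dg Bv C w) (hDg : Dg ≤ 2 * c') (hDg4 : 4 ≤ Dg)
    (hbal : n ≤ 4 * (2 * c' + 1)) (hq : 40 * q ≤ n) (hn₁ : n₁ + 2 * q ≤ n)
    (hTq : T + 2 * q + 2 ≤ 2 * c' + 1) (hqD : q ≤ Dg) (hDq3 : Dg + 2 * q + 3 ≤ 2 * c' + 1) (hqN : 2 * q * q + q ≤ n / 2) (hτ : 1 ≤ τ)
    (hH : ∀ (m t'' D' : ℕ) (w' : ℕ → ℝ), n₁ ≤ m → Even m → Odd t'' → m ≤ 5 * t'' → m ≤ 5 * (m - t'') →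
      T ≤ t'' → T ≤ m - t'' → D' + 3 ≤ t'' → D' + 3 ≤ m - t'' → Dg ≤ D' + q → D' ≤ Dg →
      (∀ c ∈ C, (Qset m t'' c).Nonempty) →
      (∀ p : Polynomial ℝ, p.natDegree ≤ D' → ∑ c ∈ C, w' c * p.eval (c : ℝ) = -p.eval 0) →
      ∑ c ∈ C, |w' c| ≤ Bv →
      ∀ (X' : OddSet m → Matrix (Fin r) (Fin r) ℝ) (Y' : PMatch m → Matrix (Fin r) (Fin r) ℝ), IsPsdRect X' Y' →
      ∀ (A' : Finset (OddSet m)), (∀ U ∈ A', U.1.card = t'') →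
      ∀ (B' : Finset (PMatch m)),
      IsRelHomogeneousW τ (perfectMatchings (univ : Finset (Fin m)))
        (fun M : Finset (Sym2 (Fin m)) => if hM : IsPMOn univ M then (Y' ⟨M, hM⟩).trace / r else 0) (B'.image Subtype.val) →
      Real.exp (-(c₀ * dq m)) ≤ (∑ U ∈ A', (X' U).trace) / ((r : ℝ) * (m.choose t'' : ℝ)) →
      Real.exp (-(c₀ * dq m)) ≤ (∑ M ∈ B', (Y' M).trace) / ((r : ℝ) * (Fintype.card (PMatch m) : ℝ)) →
      ∑ U ∈ A', ∑ M ∈ B', levelWeight m t'' C w' U M * (X' U * Y' M).trace ≤ Bv * Ψ * r)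
    (hΨ : 0 ≤ Ψ) (hβ : ∀ m : ℕ, n ≤ m + 2 * q → m ≤ n → Real.exp (-(c₀ * dq m)) ≤ β) (hβ0 : 0 ≤ β) :
    TracialValueLEAt (levelWeight n (2 * c' + 1) C w)
      (Bv * ((τ ^ (q + 1))⁻¹ + τ ^ (q + 1) * (n : ℝ) ^ q *
        ((4 : ℝ) ^ q * Real.sqrt (∏ j ∈ range ((Dg - 4) / 2 + 1), ((2 * j + 1 : ℝ) / ((n : ℝ) - 2 * j)))) +
        2 * (4 : ℝ) ^ q * τ ^ (q + 1) * (Ψ + β))) r := by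
  classical
  intro X Y hXY
  have hr' : (0 : ℝ) < r := by exact_mod_cast hr
  have hy := fun M => traceWeight_mem hXY M
  obtain ⟨Dk⟩ := exists_weightedSpreadApproximation (image_val_subset (univ : Finset (PMatch n))) (fun M => (hy M).1) (fun M => (hy M).2) hτ q
  -- the weight lives on the `t`-cuts
  have hcut : ∑ U, ∑ M, levelWeight n (2 * c' + 1) C w U M * (X U * Y M).trace =
      ∑ U ∈ univ.filter (fun U : OddSet n => U.1.card = 2 * c' + 1), ∑ M ∈ (univ : Finset (PMatch n)),
        levelWeight n (2 * c' + 1) C w U M * (X U * Y M).trace := by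
    rw [sum_filter]
    refine sum_congr rfl fun U _ => ?_
    split_ifs with hU
    · rfl
    · refine sum_eq_zero fun M _ => ?_
      have h0 : levelWeight n (2 * c' + 1) C w U M = 0 := by
        unfold levelWeight
        exact sum_eq_zero fun c _ => by rw [if_neg]; exact fun h => hU (mem_Qset_iff.1 h).1
      rw [h0, zero_mul]
  have h3 := psd_value_le_three_terms hn hn1 hr hdes hDg hDg4 hbal hq hn₁ hTq hqD hDq3 hqN (lt_of_lt_of_le one_pos hτ) hH hΨ hβ hβ0 hXY
    (univ.filter fun U : OddSet n => U.1.card = 2 * c' + 1) (fun U hU => (mem_filter.1 hU).2) univ Dk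
  rw [hcut, div_le_iff₀ hr']
  calc _ ≤ _ := h3
    _ = _ := by ring

end Summit.PneNP.PneNP.Theorems.ChebyshevTracialDesignPsdAssembly
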